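import Literature.Probability.Percolation.BergKahnLogSupermodular
import HarnessLib

/-!
# The vdBK–covariance form of the C-free pair law (AC): identity, the new regime `Cov(F,G ∣ x↔a) ≥ 0`, and (Ψ4) ⟹ (K) ⟹ (AC)
(BENCH rows M2-R76 / M2-R77, PROOFS §P63; gen 21 of the constants-miner seat `prim-rate-mine-2`, lane prim-rate (c))

Support file (`--supports stmt-CriticalPhenomena-4575`).  No definitions, no named facts, no sorries.  Continues
`…QuantitativePairABCovariance.lean` (gen 20: (AC′)/(AC) in the regime `τ_b ≤ τ_a`, the `α ≥ 0` half); to stay independent of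
the farm's build state of that module it imports only `Literature.Probability.Percolation.BergKahnLogSupermodular` and re-derives
the van den Berg–Kahn instance at `t = b` inline where needed (inside `CSH.pab_AC_nonneg_of_K`).

SETTING.  `μ = prodBernoulli w`, vertices `x, a, b, u`, `T = {x↔a}`, `F = {x↔b}`, `G = {x↔u}`, `τ_A = μ(⋂_{v∈A} {x↔v})`;
the (AC) functional of BENCH l.226 (B) / PROOFS §P60 (d) is
`AC = τ_{au} − τ_aτ_u + τ_{au}(τ_{ab} − 2τ_b) + τ_{bu}(2τ_a − τ_{ab}) + τ_{abu}(τ_b − τ_a)`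
(`= τ_{au}μ(R_{ab}) + τ_{bu}μ(Q_aR_b) − τ_aμ(Q_uR_{ab}) − τ_bμ(Q_{au}R_b)`; `AC ≥ 0` gives `N_{ab} ≥ 0`, i.e. `c_{ab} ≤ 0`, the C-free
pair law at the pairs `{a,b}`, `{a,u}`, PROOFS §P60 (c)).  With the two van den Berg–Kahn slacks
`W_b = μ(Q_{au}R_b)μ(R_b) − μ(Q_aR_b)μ(Q_uR_b) ≥ 0`, `W_a = μ(Q_{bu}R_a)μ(R_a) − μ(Q_bR_a)μ(Q_uR_a) ≥ 0` (Thm 1.1 of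
van den Berg–Kahn at `t = b`, `t = a`) and `Cov(F,G) = τ_{bu} − τ_bτ_u ≥ 0` (Harris):

* `CSH.pab_AC_eq_vdBK_cov` — the IDENTITY `AC = W_b + Cov(F,G) − W_a` (so (AC) ⟺ `W_a − W_b ≤ Cov(F,G)`);
* `CSH.pab_AC_nonneg_of_K` — (AC) ⟸ (K) `W_a ≤ Cov(F,G)`, i.e. `μ(x↮a)²·Cov(F,G ∣ x↮a) ≤ Cov(F,G)`;
* `CSH.pab_cov_sub_Wa_eq` — the IDENTITY `τ_a(Cov(F,G) − W_a) = (1−τ_a)(τ_aτ_{abu} − τ_{ab}τ_{au}) + τ_a²Cov(F,G) + Cov(T,F)Cov(T,G)`;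
* **`CSH.pab_K_of_condCov_nonneg`, `CSH.pab_AC_nonneg_of_condCov_nonneg`** — THE NEW REGIME: if `τ_{ab}τ_{au} ≤ τ_aτ_{abu}`
  (`x↔b`, `x↔u` non-negatively correlated GIVEN `x↔a`) then (K), hence (AC), with no hypothesis on the order of `τ_a`, `τ_b`
  (complements `CSH.pab_AC_nonneg_of_le`, the regime `τ_b ≤ τ_a`);
* `CSH.pab_K_of_psi4` — the conjectured four-point inequality (Ψ4) `τ_{abu} + τ_aτ_{bu} ≥ τ_bτ_{au} + τ_uτ_{ab}`
  (BENCH row M2-R77; `= E[(1_{F′}−1_F)(1_{G′}−1_G); x↔a] ≥ 0` for two independent copies; 0 failures in the census) implies (K)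
  for all weights.
[cite: Harris1960, Lemma 4.1 (p. 16)] [cite: VandenbergKahn2001, Thm 1.1 (p. 123)]
-/

noncomputable section

namespace Summit.CriticalPhenomena.PercolationContinuityZ3.Theorems.CSH

open MeasureTheory Set unitInterval
open Literature.Probability.LatticeModels (prodBernoulli prodBernoulli_harris)
open Literature.Probability.Percolation
open scoped Classical

variable {V : Type} [Fintype V] [DecidableEq V]

section VdBKCovariance

/-! ### The vdBK–covariance identity for (AC), the new regime `Cov(F,G ∣ x↔a) ≥ 0`, and the reductions (Ψ4) ⟹ (K) ⟹ (AC)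

With the van den Berg–Kahn slacks `W_b = μ(Q_{au}R_b)μ(R_b) − μ(Q_aR_b)μ(Q_uR_b)`, `W_a = μ(Q_{bu}R_a)μ(R_a) − μ(Q_bR_a)μ(Q_uR_a)`
(both `≥ 0`: van den Berg–Kahn Thm 1.1 at `t = b` / `t = a`, `CSH.pabc_vdBK_b/_a` in the gen-20 file) the (AC) functional of BENCH l.226 (B) is EXACTLY
`A + C = W_b + Cov(F,G) − W_a` (`pab_AC_eq_vdBK_cov`).  Hence (AC) ⟸ (K) `W_a ≤ Cov(F,G)`, i.e.
`μ(x↮a)²·Cov(F,G ∣ x↮a) ≤ Cov(F,G)` (`pab_AC_nonneg_of_K`), and the identity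
`τ_a·(Cov(F,G) − W_a) = (1 − τ_a)·(τ_aτ_{abu} − τ_{ab}τ_{au}) + τ_a²·Cov(F,G) + Cov(T,F)·Cov(T,G)` (`pab_cov_sub_Wa_eq`) proves (K) — hence
(AC) and `N_{ab} ≥ 0` — in the NEW REGIME `τ_aτ_{abu} ≥ τ_{ab}τ_{au}`, i.e. whenever `x↔b`, `x↔u` are non-negatively correlated
GIVEN `x↔a` (`pab_K_of_condCov_nonneg`, `pab_AC_nonneg_of_condCov_nonneg`; no hypothesis on the order of `τ_a, τ_b`).
Finally the four-point inequality (Ψ4) `τ_{abu} + τ_aτ_{bu} ≥ τ_bτ_{au} + τ_uτ_{ab}` (BENCH row M2-R77, conjectured for all weighted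
graphs; `= E[(1_{F'}−1_F)(1_{G'}−1_G); x↔a]` for two independent copies) implies (K) for all weights (`pab_K_of_psi4`). -/

variable (w : Sym2 V → unitInterval) (x a b u : V)

omit [Fintype V] [DecidableEq V] in
/-- **The vdBK–covariance identity for (AC)** (PROOFS §P63 (d)): the (AC) functional of BENCH l.226 (B),
`AC = τ_{au} − τ_aτ_u + τ_{au}(τ_{ab} − 2τ_b) + τ_{bu}(2τ_a − τ_{ab}) + τ_{abu}(τ_b − τ_a)`, equals
`W_b + Cov(F,G) − W_a` with `W_b = (τ_{au} − τ_{abu})(1 − τ_b) − (τ_a − τ_{ab})(τ_u − τ_{bu})`,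
`W_a = (τ_{bu} − τ_{abu})(1 − τ_a) − (τ_b − τ_{ab})(τ_u − τ_{au})` the two van den Berg–Kahn slacks and `Cov(F,G) = τ_{bu} − τ_bτ_u`.
A polynomial identity (`ring`); it exhibits (AC) as «the difference of the two vdBK slacks is at most the Harris covariance». [folklore] -/
theorem pab_AC_eq_vdBK_cov :
    (prodBernoulli w).real (openConn x a ∩ openConn x u) - (prodBernoulli w).real (openConn x a) * (prodBernoulli w).real (openConn x u)
        + (prodBernoulli w).real (openConn x a ∩ openConn x u) * ((prodBernoulli w).real (openConn x a ∩ openConn x b) - 2 * (prodBernoulli w).real (openConn x b))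
        + (prodBernoulli w).real (openConn x b ∩ openConn x u) * (2 * (prodBernoulli w).real (openConn x a) - (prodBernoulli w).real (openConn x a ∩ openConn x b))
        + (prodBernoulli w).real (openConn x a ∩ openConn x b ∩ openConn x u) * ((prodBernoulli w).real (openConn x b) - (prodBernoulli w).real (openConn x a))
      = (((prodBernoulli w).real (openConn x a ∩ openConn x u) - (prodBernoulli w).real (openConn x a ∩ openConn x b ∩ openConn x u)) *
            (1 - (prodBernoulli w).real (openConn x b))
          - ((prodBernoulli w).real (openConn x a) - (prodBernoulli w).real (openConn x a ∩ openConn x b)) *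
            ((prodBernoulli w).real (openConn x u) - (prodBernoulli w).real (openConn x b ∩ openConn x u)))
        + ((prodBernoulli w).real (openConn x b ∩ openConn x u) - (prodBernoulli w).real (openConn x b) * (prodBernoulli w).real (openConn x u))
        - (((prodBernoulli w).real (openConn x b ∩ openConn x u) - (prodBernoulli w).real (openConn x a ∩ openConn x b ∩ openConn x u)) *
            (1 - (prodBernoulli w).real (openConn x a))
          - ((prodBernoulli w).real (openConn x b) - (prodBernoulli w).real (openConn x a ∩ openConn x b)) *
            ((prodBernoulli w).real (openConn x u) - (prodBernoulli w).real (openConn x a ∩ openConn x u))) := by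
  ring

/-- **(AC) from (K)** (PROOFS §P63 (d)): if the van den Berg–Kahn slack at `t = a` is at most the Harris covariance,
`W_a = (τ_{bu} − τ_{abu})(1 − τ_a) − (τ_b − τ_{ab})(τ_u − τ_{au}) ≤ τ_{bu} − τ_bτ_u = Cov(F,G)` — equivalently
`μ(x↮a)²·Cov(1_{x↔b}, 1_{x↔u} ∣ x↮a) ≤ Cov(1_{x↔b}, 1_{x↔u})` — then the (AC) functional of BENCH l.226 (B) is `≥ 0`
(by `pab_AC_eq_vdBK_cov` and `W_b ≥ 0`, van den Berg–Kahn Thm 1.1 at `t = b`). [cite: VandenbergKahn2001, Thm 1.1 (p. 123)] -/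
theorem pab_AC_nonneg_of_K
    (hK : ((prodBernoulli w).real (openConn x b ∩ openConn x u) - (prodBernoulli w).real (openConn x a ∩ openConn x b ∩ openConn x u)) *
              (1 - (prodBernoulli w).real (openConn x a))
            - ((prodBernoulli w).real (openConn x b) - (prodBernoulli w).real (openConn x a ∩ openConn x b)) *
              ((prodBernoulli w).real (openConn x u) - (prodBernoulli w).real (openConn x a ∩ openConn x u))
          ≤ (prodBernoulli w).real (openConn x b ∩ openConn x u) - (prodBernoulli w).real (openConn x b) * (prodBernoulli w).real (openConn x u)) :
    0 ≤ (prodBernoulli w).real (openConn x a ∩ openConn x u) - (prodBernoulli w).real (openConn x a) * (prodBernoulli w).real (openConn x u)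
        + (prodBernoulli w).real (openConn x a ∩ openConn x u) * ((prodBernoulli w).real (openConn x a ∩ openConn x b) - 2 * (prodBernoulli w).real (openConn x b))
        + (prodBernoulli w).real (openConn x b ∩ openConn x u) * (2 * (prodBernoulli w).real (openConn x a) - (prodBernoulli w).real (openConn x a ∩ openConn x b))
        + (prodBernoulli w).real (openConn x a ∩ openConn x b ∩ openConn x u) * ((prodBernoulli w).real (openConn x b) - (prodBernoulli w).real (openConn x a)) := by
  -- van den Berg–Kahn Thm 1.1 at `t = b` in `τ`-coordinates: `W_b ≥ 0` (derived inline from `BergKahn.bergKahn_thm_1_1`;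
  -- the same statement is `CSH.pabc_vdBK_b` of the gen-20 file)
  have hWb : ((prodBernoulli w).real (openConn x a) - (prodBernoulli w).real (openConn x a ∩ openConn x b)) *
        ((prodBernoulli w).real (openConn x u) - (prodBernoulli w).real (openConn x b ∩ openConn x u)) ≤
      ((prodBernoulli w).real (openConn x a ∩ openConn x u) - (prodBernoulli w).real (openConn x a ∩ openConn x b ∩ openConn x u)) *
        (1 - (prodBernoulli w).real (openConn x b)) := by
    have h := BergKahn.bergKahn_thm_1_1 w x a u b
    set μ := prodBernoulli w with hμ
    have hic : ∀ (A B : Set (BondConfig V)), μ.real (A ∩ Bᶜ) = μ.real A - μ.real (A ∩ B) := by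
      intro A B
      have h1 := measureReal_inter_add_sdiff (μ := μ) (s := A) (t := B) MeasurableSet.of_discrete
      rw [Set.sdiff_eq_compl_inter, Set.inter_comm Bᶜ A] at h1
      linarith
    have hc : ∀ (B : Set (BondConfig V)), μ.real Bᶜ = 1 - μ.real B :=
      fun B => probReal_compl_eq_one_sub MeasurableSet.of_discrete
    rw [hic, hic, hic, hc] at h
    have e1 : (openConn x u ∩ openConn x b : Set (BondConfig V)) = openConn x b ∩ openConn x u := Set.inter_comm _ _
    have e2 : (openConn x a ∩ openConn x u ∩ openConn x b : Set (BondConfig V)) = openConn x a ∩ openConn x b ∩ openConn x u := by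
      ext ω; simp only [Set.mem_inter_iff]; tauto
    rw [e1, e2] at h
    exact h
  rw [pab_AC_eq_vdBK_cov]
  linarith

omit [Fintype V] [DecidableEq V] in
/-- **Identity behind the new regime** (PROOFS §P63 (e)): with `Cov(F,G) = τ_{bu} − τ_bτ_u` and `W_a` the vdBK slack at `t = a`,
`τ_a·(Cov(F,G) − W_a) = (1 − τ_a)·(τ_a·τ_{abu} − τ_{ab}·τ_{au}) + τ_a²·Cov(F,G) + Cov(T,F)·Cov(T,G)`,
where `τ_aτ_{abu} − τ_{ab}τ_{au} = τ_a²·Cov(1_{x↔b}, 1_{x↔u} ∣ x↔a)`.  A polynomial identity (`ring`). [folklore] -/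
theorem pab_cov_sub_Wa_eq :
    (prodBernoulli w).real (openConn x a) *
        (((prodBernoulli w).real (openConn x b ∩ openConn x u) - (prodBernoulli w).real (openConn x b) * (prodBernoulli w).real (openConn x u))
          - (((prodBernoulli w).real (openConn x b ∩ openConn x u) - (prodBernoulli w).real (openConn x a ∩ openConn x b ∩ openConn x u)) *
                (1 - (prodBernoulli w).real (openConn x a))
              - ((prodBernoulli w).real (openConn x b) - (prodBernoulli w).real (openConn x a ∩ openConn x b)) *
                ((prodBernoulli w).real (openConn x u) - (prodBernoulli w).real (openConn x a ∩ openConn x u))))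
      = (1 - (prodBernoulli w).real (openConn x a)) *
            ((prodBernoulli w).real (openConn x a) * (prodBernoulli w).real (openConn x a ∩ openConn x b ∩ openConn x u)
              - (prodBernoulli w).real (openConn x a ∩ openConn x b) * (prodBernoulli w).real (openConn x a ∩ openConn x u))
        + (prodBernoulli w).real (openConn x a) ^ 2 *
            ((prodBernoulli w).real (openConn x b ∩ openConn x u) - (prodBernoulli w).real (openConn x b) * (prodBernoulli w).real (openConn x u))
        + ((prodBernoulli w).real (openConn x a ∩ openConn x b) - (prodBernoulli w).real (openConn x a) * (prodBernoulli w).real (openConn x b)) *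
            ((prodBernoulli w).real (openConn x a ∩ openConn x u) - (prodBernoulli w).real (openConn x a) * (prodBernoulli w).real (openConn x u)) := by
  ring

omit [DecidableEq V] in
/-- **(K) in the regime `Cov(F,G ∣ x↔a) ≥ 0`** (PROOFS §P63 (e)): if `τ_{ab}·τ_{au} ≤ τ_a·τ_{abu}` (the connection events
`x↔b`, `x↔u` are non-negatively correlated given `x↔a`), then `W_a ≤ Cov(F,G)`: by `pab_cov_sub_Wa_eq` the three terms on the
right are non-negative (hypothesis; Harris for `(F,G)`; Harris for `(T,F)` times Harris for `(T,G)`), and the degenerate case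
`τ_a = 0` forces `τ_{ab} = τ_{au} = τ_{abu} = 0` and `W_a = Cov(F,G)`. [cite: Harris1960, Lemma 4.1 (p. 16)] -/
theorem pab_K_of_condCov_nonneg
    (hcc : (prodBernoulli w).real (openConn x a ∩ openConn x b) * (prodBernoulli w).real (openConn x a ∩ openConn x u)
          ≤ (prodBernoulli w).real (openConn x a) * (prodBernoulli w).real (openConn x a ∩ openConn x b ∩ openConn x u)) :
    ((prodBernoulli w).real (openConn x b ∩ openConn x u) - (prodBernoulli w).real (openConn x a ∩ openConn x b ∩ openConn x u)) *
          (1 - (prodBernoulli w).real (openConn x a))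
        - ((prodBernoulli w).real (openConn x b) - (prodBernoulli w).real (openConn x a ∩ openConn x b)) *
          ((prodBernoulli w).real (openConn x u) - (prodBernoulli w).real (openConn x a ∩ openConn x u))
      ≤ (prodBernoulli w).real (openConn x b ∩ openConn x u) - (prodBernoulli w).real (openConn x b) * (prodBernoulli w).real (openConn x u) := by
  have hid := pab_cov_sub_Wa_eq w x a b u
  set μ := prodBernoulli w with hμ
  set ta := μ.real (openConn x a)
  set tb := μ.real (openConn x b)
  set tu := μ.real (openConn x u)
  set tab := μ.real (openConn x a ∩ openConn x b)
  set tau := μ.real (openConn x a ∩ openConn x u)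
  set tbu := μ.real (openConn x b ∩ openConn x u)
  set tabu := μ.real (openConn x a ∩ openConn x b ∩ openConn x u)
  have hTG : ta * tu ≤ tau := prodBernoulli_harris w (isUpperSet_openConn x a) (isUpperSet_openConn x u)
    MeasurableSet.of_discrete MeasurableSet.of_discrete
  have hFG : tb * tu ≤ tbu := prodBernoulli_harris w (isUpperSet_openConn x b) (isUpperSet_openConn x u)
    MeasurableSet.of_discrete MeasurableSet.of_discrete
  have hTF : ta * tb ≤ tab := prodBernoulli_harris w (isUpperSet_openConn x a) (isUpperSet_openConn x b)
    MeasurableSet.of_discrete MeasurableSet.of_discrete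
  have hta0 : 0 ≤ ta := measureReal_nonneg
  have hta1 : ta ≤ 1 := measureReal_le_one
  have htab0 : 0 ≤ tab := measureReal_nonneg
  have htau0 : 0 ≤ tau := measureReal_nonneg
  have htabu0 : 0 ≤ tabu := measureReal_nonneg
  have htab_le : tab ≤ ta := measureReal_mono Set.inter_subset_left
  have htau_le : tau ≤ ta := measureReal_mono Set.inter_subset_left
  have htabu_le : tabu ≤ tab := measureReal_mono (show (openConn x a ∩ openConn x b ∩ openConn x u : Set (BondConfig V))
      ⊆ openConn x a ∩ openConn x b from Set.inter_subset_left)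
  -- the right-hand side of the identity is non-negative
  have hprod : 0 ≤ ta * ((tbu - tb * tu) - ((tbu - tabu) * (1 - ta) - (tb - tab) * (tu - tau))) := by
    rw [hid]
    have h1 : 0 ≤ (1 - ta) * (ta * tabu - tab * tau) := mul_nonneg (by linarith) (by linarith)
    have h2 : 0 ≤ ta ^ 2 * (tbu - tb * tu) := mul_nonneg (sq_nonneg ta) (by linarith)
    have h3 : 0 ≤ (tab - ta * tb) * (tau - ta * tu) := mul_nonneg (by linarith) (by linarith)
    linarith
  by_cases hz : ta = 0
  · -- degenerate case τ_a = 0: all joint connection probabilities through `a` vanish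
    have e1 : tab = 0 := le_antisymm (by linarith) htab0
    have e2 : tau = 0 := le_antisymm (by linarith) htau0
    have e3 : tabu = 0 := le_antisymm (by linarith) htabu0
    rw [hz, e1, e2, e3]; ring_nf; linarith
  · have hta_pos : 0 < ta := lt_of_le_of_ne hta0 (Ne.symm hz)
    have := (mul_nonneg_iff_of_pos_left hta_pos).1 hprod
    linarith

/-- **(AC) — hence `N_{ab} ≥ 0` towards `c_{ab} ≤ 0` — in the NEW REGIME `Cov(1_{x↔b}, 1_{x↔u} ∣ x↔a) ≥ 0`**
(PROOFS §P63 (e); BENCH row M2-R76): if `τ_{ab}·τ_{au} ≤ τ_a·τ_{abu}` then the (AC) functional of BENCH l.226 (B) is `≥ 0`,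
with NO hypothesis on the order of `τ_a, τ_b` (so it covers part of the tower regime `τ_b > τ_a` left open by
`CSH.pab_AC_nonneg_of_le`).  Proof: `pab_K_of_condCov_nonneg` and `pab_AC_nonneg_of_K`.
[cite: Harris1960, Lemma 4.1 (p. 16)] [cite: VandenbergKahn2001, Thm 1.1 (p. 123)] -/
theorem pab_AC_nonneg_of_condCov_nonneg
    (hcc : (prodBernoulli w).real (openConn x a ∩ openConn x b) * (prodBernoulli w).real (openConn x a ∩ openConn x u)
          ≤ (prodBernoulli w).real (openConn x a) * (prodBernoulli w).real (openConn x a ∩ openConn x b ∩ openConn x u)) :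
    0 ≤ (prodBernoulli w).real (openConn x a ∩ openConn x u) - (prodBernoulli w).real (openConn x a) * (prodBernoulli w).real (openConn x u)
        + (prodBernoulli w).real (openConn x a ∩ openConn x u) * ((prodBernoulli w).real (openConn x a ∩ openConn x b) - 2 * (prodBernoulli w).real (openConn x b))
        + (prodBernoulli w).real (openConn x b ∩ openConn x u) * (2 * (prodBernoulli w).real (openConn x a) - (prodBernoulli w).real (openConn x a ∩ openConn x b))
        + (prodBernoulli w).real (openConn x a ∩ openConn x b ∩ openConn x u) * ((prodBernoulli w).real (openConn x b) - (prodBernoulli w).real (openConn x a)) :=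
  pab_AC_nonneg_of_K w x a b u (pab_K_of_condCov_nonneg w x a b u hcc)

omit [DecidableEq V] in
/-- **(Ψ4) ⟹ (K)** (PROOFS §P63 (e)): the conjectured four-point inequality (Ψ4) of BENCH row M2-R77,
`τ_b·τ_{au} + τ_u·τ_{ab} ≤ τ_{abu} + τ_a·τ_{bu}` (`= E[(1_{F'} − 1_F)(1_{G'} − 1_G); x↔a] ≥ 0` for two independent copies),
implies the vdBK–covariance bound (K) `W_a ≤ Cov(F,G)` for all weights: `(Cov(F,G) − W_a) − (Ψ4-slack) = τ_{ab}τ_{au} − τ_aτ_{abu}`,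
so (K) follows from (Ψ4) when `Cov(F,G ∣ x↔a) ≤ 0` and from `pab_K_of_condCov_nonneg` otherwise.
[cite: Harris1960, Lemma 4.1 (p. 16)] -/
theorem pab_K_of_psi4
    (hpsi : (prodBernoulli w).real (openConn x b) * (prodBernoulli w).real (openConn x a ∩ openConn x u)
            + (prodBernoulli w).real (openConn x u) * (prodBernoulli w).real (openConn x a ∩ openConn x b)
          ≤ (prodBernoulli w).real (openConn x a ∩ openConn x b ∩ openConn x u)
            + (prodBernoulli w).real (openConn x a) * (prodBernoulli w).real (openConn x b ∩ openConn x u)) :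
    ((prodBernoulli w).real (openConn x b ∩ openConn x u) - (prodBernoulli w).real (openConn x a ∩ openConn x b ∩ openConn x u)) *
          (1 - (prodBernoulli w).real (openConn x a))
        - ((prodBernoulli w).real (openConn x b) - (prodBernoulli w).real (openConn x a ∩ openConn x b)) *
          ((prodBernoulli w).real (openConn x u) - (prodBernoulli w).real (openConn x a ∩ openConn x u))
      ≤ (prodBernoulli w).real (openConn x b ∩ openConn x u) - (prodBernoulli w).real (openConn x b) * (prodBernoulli w).real (openConn x u) := by
  by_cases hcc : (prodBernoulli w).real (openConn x a ∩ openConn x b) * (prodBernoulli w).real (openConn x a ∩ openConn x u)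
          ≤ (prodBernoulli w).real (openConn x a) * (prodBernoulli w).real (openConn x a ∩ openConn x b ∩ openConn x u)
  · exact pab_K_of_condCov_nonneg w x a b u hcc
  · rw [not_le] at hcc
    set μ := prodBernoulli w with hμ
    set ta := μ.real (openConn x a)
    set tb := μ.real (openConn x b)
    set tu := μ.real (openConn x u)
    set tab := μ.real (openConn x a ∩ openConn x b)
    set tau := μ.real (openConn x a ∩ openConn x u)
    set tbu := μ.real (openConn x b ∩ openConn x u)
    set tabu := μ.real (openConn x a ∩ openConn x b ∩ openConn x u)
    -- (Cov − W_a) = (Ψ4-slack) + (τ_ab τ_au − τ_a τ_abu)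
    have hid : (tbu - tb * tu) - ((tbu - tabu) * (1 - ta) - (tb - tab) * (tu - tau))
        = ((tabu + ta * tbu) - (tb * tau + tu * tab)) + (tab * tau - ta * tabu) := by ring
    nlinarith [hid, hpsi, hcc]

end VdBKCovariance

end Summit.CriticalPhenomena.PercolationContinuityZ3.Theorems.CSH
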